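import Summits.CriticalPhenomena.PercolationContinuityZ3.Theorems.PercNearOneGluingNoHeavyQuantWindowExtremePieces
import HarnessLib

/-!
# QUANT lane R8, T-DEC: extreme points of the window polytope are small — the case of a saturated layer WITH a giant of positive mass
# above the top layer (memo WINDOW-ATOMS-G57 §2.4 case (A), file H5 part 5)

builds on p205010 (kernel theorem, internal audit signed; external expert review pending)

Support file (`--supports stmt-CriticalPhenomena-4575`), QUANT lane seat prim-quant-census-2 (gen 57), rung R8 of
`run/shared/lean/prim/quant/LADDER.md`.  One theorem, standard axioms, no sorries.

* **`LawDec.smallLaw_of_tight_giant`** — `v` extreme in `windowSet x T M j w` (`0 < x < 1`); `J*` the LARGEST unflipped window layer whose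
  giant pool is nonempty and exactly saturated by the truncated top corner run; and some position `g > j` carries mass.  Then
  `SmallLaw T j M (vecLaw M v)`.  Saturation gives a low `l₀` with leftover or with a corner segment `(l₀, h₀)` beyond `J*`; the pieces are
  `u·e_g + e_{l₀}` resp. `(e_{l₀} + c₀ e_{h₀}) + (u − c₀)·e_g`, whose pool change vanishes at every saturated layer (all `≤ J*`);
  `smallLaw_of_pieces` concludes.

[this work]; nothing here is cited as a published result.  The gluing rows served [cite: KozmaNitzan2024, Conjecture 3 (p. 15)]; product
measure [cite: Grimmett1999, §1.3 p. 10].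
-/

noncomputable section

namespace Summit.CriticalPhenomena.PercolationContinuityZ3.Theorems

namespace Quant

open Finset

namespace LawDec

/-- indicator of equality of naturals, as a real number -/
local notation3 "𝟙[" a ", " b "]" => (if (a : ℕ) = (b : ℕ) then (1 : ℝ) else 0)

/-- **THE SATURATED CASE WITH A GIANT ABOVE THE TOP LAYER** (memo §2.4 (A)). [this work] -/
theorem smallLaw_of_tight_giant (x T : ℝ) (M j w : ℕ) (v : Fin (M + 1) → ℝ) (hx0 : 0 < x) (hx1 : x < 1)
    (hvext : v ∈ (windowSet x T M j w).extremePoints ℝ) (Js : ℕ)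
    (hS : x / (1 - x) * windowS x T j M (vecLaw M v) Js = ∑ h ∈ Finset.Ico (Js + 1) (M + 1), vecLaw M v h)
    (hΓ : 0 < ∑ h ∈ Finset.Ico (Js + 1) (M + 1), vecLaw M v h)
    (hmax : ∀ J, J ≤ j → j ≤ J + w → (∀ l, J < l → l ≤ j → 2 * (l : ℝ) < T → vecLaw M v l = 0) →
      x / (1 - x) * windowS x T j M (vecLaw M v) J = ∑ h ∈ Finset.Ico (J + 1) (M + 1), vecLaw M v h →
      0 < ∑ h ∈ Finset.Ico (J + 1) (M + 1), vecLaw M v h → J ≤ Js)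
    (g : ℕ) (hjg : j < g) (hgM : g ≤ M) (hgne : vecLaw M v g ≠ 0) :
    SmallLaw T j M (vecLaw M v) := by
  classical
  have hv : v ∈ windowSet x T M j w := hvext.1
  set μ : ℕ → ℝ := vecLaw M v with hμdef
  have hμ0 : ∀ k, 0 ≤ μ k := fun k => by
    by_cases hk : k < M + 1
    · rw [hμdef, vecLaw_apply_of_lt v hk]; exact hv.1 _
    · rw [hμdef, vecLaw, dif_neg hk]
  have hμM : ∀ h, M < h → μ h = 0 := fun h hh => vecLaw_apply_of_gt v hh
  have hu : 0 < x / (1 - x) := div_pos hx0 (by linarith)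
  obtain ⟨hF0, hsup, hrow, hcol⟩ := cornerFlow_inv x T j M μ hx0 hx1 hμ0 ((j + 1) * (j + 1)) le_rfl
  have hleM : ∀ b, 0 < μ b → b ≤ M := fun b hb => by
    by_contra hgt; push Not at hgt; linarith [hμM b hgt]
  have hleft0 : ∀ l, 0 ≤ cornerLeftover x T j M μ l := fun l => by
    unfold cornerLeftover cornerMidFlow; linarith [hrow l]
  have hLft_le : ∀ l, cornerLeftover x T j M μ l ≤ μ l := fun l => by
    have : 0 ≤ ∑ b ∈ Finset.range (M + 1), cornerFlow x T j M μ ((j + 1) * (j + 1)) l b :=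
      Finset.sum_nonneg fun b _ => hF0 l b
    unfold cornerLeftover cornerMidFlow; linarith
  have hgpos : 0 < μ g := lt_of_le_of_ne (hμ0 g) (Ne.symm hgne)
  have hloadg : ∑ a ∈ Finset.range (j + 1), usage x T j a g * cornerMidFlow x T j M μ a g = 0 := by
    refine Finset.sum_eq_zero fun a _ => ?_
    by_cases hz : cornerMidFlow x T j M μ a g = 0
    · rw [hz, mul_zero]
    · have := (hsup a g hz).2.1; omega
  have hresg : 0 < μ g - ∑ a ∈ Finset.range (j + 1), usage x T j a g * cornerMidFlow x T j M μ a g := by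
    rw [hloadg, sub_zero]; exact hgpos
  -- saturation yields a low carrying leftover or a segment beyond `J*`
  have hSpos : 0 < windowS x T j M μ Js := by
    by_contra hle; push Not at hle; nlinarith
  obtain ⟨l₀, hl₀mem, hl₀ne⟩ := Finset.exists_ne_zero_of_sum_ne_zero (ne_of_gt hSpos)
  obtain ⟨hl₀r, hl₀low⟩ := Finset.mem_filter.1 hl₀mem
  have hl₀j : l₀ ≤ j := Nat.lt_succ_iff.1 (Finset.mem_range.1 hl₀r)
  have hinner0 : ∀ h, 0 ≤ (if Js < h ∧ h ≤ j then cornerMidFlow x T j M μ l₀ h else 0) := fun h => by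
    split_ifs
    · exact hF0 l₀ h
    · exact le_rfl
  by_cases hL : 0 < cornerLeftover x T j M μ l₀
  · -- (A1) the pieces `u·e_g + e_{l₀}`
    have hl₀M : l₀ ≤ M := hleM l₀ (lt_of_lt_of_le hL (hLft_le l₀))
    have hl₀g : l₀ ≠ g := by omega
    refine smallLaw_of_pieces x T M j w v hx0 hx1 hvext 0 0 0 0 g 0 l₀ 0 0 (x / (1 - x)) 0 1
      (fun h => absurd rfl h) (fun h => absurd rfl h)
      (fun _ => ⟨hgM, fun hc => by omega, hresg⟩) (fun h => absurd rfl h)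
      (fun _ => ⟨hl₀low, hl₀j, hL⟩)
      (fun J h1 _ _ _ _ => ?_) l₀ hl₀M ?_ l₀ l₀ g g hgM hgM (Or.inr (by omega)) (Or.inr (by omega)) (fun k hk => ?_)
    · unfold pieceG
      rw [if_pos (show J < g ∧ g ≤ M from ⟨by omega, hgM⟩)]
      simp only [zero_mul, mul_zero, ite_self]
      ring
    · unfold pertLaw; rw [if_neg hl₀g, if_pos rfl]; simp
    · rcases pert_support x T j μ 0 0 0 0 g 0 l₀ 0 0 (x / (1 - x)) 0 1 k hk with ⟨ht, -⟩ | ⟨ht, -⟩ | ⟨-, hk'⟩ | ⟨hs, -⟩ | ⟨-, hk'⟩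
      · exact absurd rfl ht
      · exact absurd rfl ht
      · exact Or.inr (Or.inr (Or.inl hk'))
      · exact absurd rfl hs
      · exact Or.inl hk'
  · -- (A2) no leftover at `l₀`: a corner segment `(l₀, h₀)` beyond `J*`; the pieces `(e_{l₀} + c₀ e_{h₀}) + (u − c₀)·e_g`
    have hL0 : cornerLeftover x T j M μ l₀ = 0 := le_antisymm (not_lt.1 hL) (hleft0 l₀)
    rw [hL0, zero_add] at hl₀ne
    obtain ⟨h₀, hh₀mem, hh₀ne⟩ := Finset.exists_ne_zero_of_sum_ne_zero hl₀ne
    have hcond : Js < h₀ ∧ h₀ ≤ j := by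
      by_contra hc; rw [if_neg hc] at hh₀ne; exact hh₀ne rfl
    rw [if_pos hcond] at hh₀ne
    have hF : 0 < cornerMidFlow x T j M μ l₀ h₀ := lt_of_le_of_ne (hF0 l₀ h₀) (Ne.symm hh₀ne)
    obtain ⟨q1, q2, q3, q4, q5, -⟩ := hsup l₀ h₀ hh₀ne
    have hl₀M : l₀ ≤ M := by
      have hle := Finset.single_le_sum (f := fun b => cornerFlow x T j M μ ((j + 1) * (j + 1)) l₀ b) (fun b _ => hF0 l₀ b)
        (Finset.mem_range.2 (Nat.lt_succ_of_le q4))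
      have hF' : 0 < cornerFlow x T j M μ ((j + 1) * (j + 1)) l₀ h₀ := hF
      exact hleM l₀ (by linarith [hrow l₀])
    have hl₀h₀ : l₀ ≠ h₀ := by
      intro e; have : (l₀ : ℝ) = h₀ := by exact_mod_cast e
      linarith
    have hl₀g : l₀ ≠ g := by omega
    set c₀ := usage x T j l₀ h₀ with hc₀
    refine smallLaw_of_pieces x T M j w v hx0 hx1 hvext l₀ h₀ 0 0 g 0 0 1 0 (x / (1 - x) - c₀) 0 0
      (fun _ => hF) (fun h => absurd rfl h)
      (fun _ => ⟨hgM, fun hc => by omega, hresg⟩) (fun h => absurd rfl h) (fun h => absurd rfl h)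
      (fun J h1 h2 h3 h4 h5 => ?_) l₀ hl₀M ?_ l₀ l₀ h₀ g q4 hgM (Or.inl (by linarith)) (Or.inr (by omega)) (fun k hk => ?_)
    · have hJle : J ≤ Js := hmax J h1 h2 h3 h4 h5
      unfold pieceG
      rw [if_pos (show J < h₀ ∧ h₀ ≤ M from ⟨by omega, q4⟩), if_pos (show J < h₀ by omega),
        if_pos (show J < g ∧ g ≤ M from ⟨by omega, hgM⟩)]
      simp only [zero_mul, mul_zero, ite_self]
      ring
    · unfold pertLaw; rw [if_pos rfl, if_neg hl₀h₀, if_neg hl₀g]; simp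
    · rcases pert_support x T j μ l₀ h₀ 0 0 g 0 0 1 0 (x / (1 - x) - c₀) 0 0 k hk with ⟨-, hk'⟩ | ⟨ht, -⟩ | ⟨-, hk'⟩ | ⟨hs, -⟩ | ⟨hr, -⟩
      · rcases hk' with e | e
        · exact Or.inl e
        · exact Or.inr (Or.inr (Or.inl e))
      · exact absurd rfl ht
      · exact Or.inr (Or.inr (Or.inr hk'))
      · exact absurd rfl hs
      · exact absurd rfl hr

end LawDec

end Quant

end Summit.CriticalPhenomena.PercolationContinuityZ3.Theorems
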